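import Summits.ResolutionOfSingularities.ResolutionOfSingularities.Theorems.ValuativePatchingRelDimThreeFormat
import Literature.AlgebraicGeometry.Resolution.Temkin2008LocalizationProofs
import Literature.AlgebraicGeometry.Resolution.AlterationsBlowupDivisor
import Literature.AlgebraicGeometry.Resolution.AffineDomainDimension
import HarnessLib

/-!
# Crux `PatchingRelPerfect` (stmt-ResolutionOfSingularities-16161), line `closed-point-slice`:
# stub `stub_localDesingNonClosed` — local desingularization at NON-CLOSED points of fourfolds

Route `ResolutionOfSingularities/FrobeniusClosing`, crux #6 `PatchingRelPerfect`. This file proves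
the registered stub `stub_localDesingNonClosed` of the line `closed-point-slice` (skeleton v2.1),
verbatim (`PrintedInputs → LocalDesingNonClosedFour`): for ANY field `k`, an integral separated
`k`-scheme of finite type `M` of dimension `4`, a NON-closed point `ζ ∈ M` and a blowing up
`f : X' → M`, the pro-open local scheme `X' ×_M Spec 𝒪_{M,ζ}` admits a desingularization in
Temkin's sense (`Scheme.AdmitsDesingularization`: ONE blowing up along an ideal sheaf cosupported
in the singular locus, with regular source) — modulo the two printed Cossart–Piltant facts
`CossartPiltant2019General` (Thm. 1.1) and `CossartPiltant2019Principalization` (Prop. 4.4).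

## Proof: the generic-fibre trick

1. `M` is a Jacobson space (locally of finite type over a field), so `ζ` is not closed in an
   affine open `U = Spec A ∋ ζ` either: the prime `𝔭 ⊆ A` of `ζ` is not maximal, `A` a finitely
   generated `k`-domain with `dim A = dim M = 4` (`topologicalKrullDim_eq_ringKrullDim_of_isAffineOpen`).
2. `A ⧸ 𝔭` is a domain which is not a field, hence not integral over `k`: some `t ∈ A` has
   transcendental residue, i.e. `p(t) ∉ 𝔭` for every non-zero `p ∈ k[X]`
   (`exists_forall_aeval_notMem_of_not_isMaximal`). Along `k[X] → A`, `X ↦ t`, the generic fibre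
   ring `A' = A ⊗_{k[X]} k(X) = (k[X] ∖ 0)⁻¹ A` is a finitely generated
   `K = k(X)`-domain (base change) of dimension `trdeg_K = trdeg_k − 1 = 3`
   (`ringKrullDim_genericFibreRing`: `dim = trdeg` for affine domains, additivity of `trdeg`),
   and `𝔭` survives in `A'`.
3. `ι : V = Spec A' → Spec A = U ↪ M` is a flat preimmersion through which `Spec 𝒪_{M,ζ} → M`
   factors: `ζ = ι ζ'` and `𝒪_{M,ζ} ≅ 𝒪_{V,ζ'}`. The base change `Y = X' ×_M V → V` is a blowing
   up (`IsBlowup.pullback_snd_of_flat`) of the integral threefold `V` over `K`; if its centre is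
   zero `Y = ∅`, otherwise `Y` is an integral threefold over `K` (an alteration of `V`,
   `isAlteration_of_isBlowup`, `IsAlteration.topologicalKrullDim_eq`) and the twin crux's theorem
   `exists_isBlowup_singSupported_isRegular_dim3_of_cossartPiltant` gives ONE `Sing Y`-supported
   blowing up `Bl_Q Y → Y` with regular source.
4. Localize at `ζ'`: `S'' = Y ×_V Spec 𝒪_{V,ζ'} → Y` is a flat preimmersion (identifies local
   rings), so `Bl_Q Y ×_Y S'' → S''` is a blowing up along `Q 𝒪_{S''}`, cosupported in
   `Sing S'' = S'' ∩ Sing Y`, with regular source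
   (`admitsDesingularization_proOpen_of_isBlowup_threefold`); finally
   `S'' ≅ X' ×_M Spec 𝒪_{V,ζ'} ≅ X' ×_M Spec 𝒪_{M,ζ}` (pullback pasting and
   `Scheme.SpecMap_stalkMap_fromSpecStalk`), and desingularizations transport along isomorphisms.

No perfectness, no local uniformization and no new named fact are used.

## Sources

* M. Temkin, *Desingularization of quasi-excellent schemes in characteristic zero*, Adv. Math.
  219 (2008) 488–522 = arXiv:math/0703678: §2.1 (pro-open subschemes, blow-ups and flat base
  change), Def. 2.2.6, Prop. 2.3.4 (iii). [Temkin2008]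
* V. Cossart, O. Piltant, *Resolution of singularities of arithmetical threefolds*, J. Algebra
  529 (2019) 268–535, Thm. 1.1 and Prop. 4.4. [CossartPiltant2019]
* U. Görtz, T. Wedhorn, *Algebraic Geometry I* (2nd ed., 2020), Thm. 5.22, Prop. 13.91.
  [GortzWedhorn2020]
* H. Matsumura, *Commutative Ring Theory*, CUP 1986, Thm. 5.6 (`dim = trdeg`). [Matsumura1987]
-/

set_option linter.dupNamespace false -- single-problem summit: doubled namespace component is forced

noncomputable section

open CategoryTheory CategoryTheory.Limits AlgebraicGeometry Literature.AlgebraicGeometry.Resolution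
open Polynomial

namespace Summit.ResolutionOfSingularities.ResolutionOfSingularities.Theorems

universe u

/-! ## Algebra: transcendental sections and the generic fibre ring -/

/-- Over a field `k`, a prime `𝔭` of a `k`-algebra `A` which is not maximal admits an element
`t ∈ A` whose residue in `A ⧸ 𝔭` is transcendental over `k`: all non-zero `k`-polynomial values
of `t` lie outside `𝔭` (otherwise the domain `A ⧸ 𝔭` is integral over `k`, hence a field). [folklore] -/
theorem exists_forall_aeval_notMem_of_not_isMaximal {k A : Type*} [Field k] [CommRing A]
    [Algebra k A] (𝔭 : Ideal A) [𝔭.IsPrime] (h𝔭 : ¬ 𝔭.IsMaximal) :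
    ∃ t : A, ∀ p : k[X], p ≠ 0 → aeval t p ∉ 𝔭 := by
  by_contra H
  push Not at H
  apply h𝔭
  rw [Ideal.Quotient.maximal_ideal_iff_isField_quotient]
  haveI : Algebra.IsIntegral k (A ⧸ 𝔭) := by
    refine ⟨fun b => ?_⟩
    obtain ⟨t, rfl⟩ := Ideal.Quotient.mk_surjective b
    obtain ⟨p, hp, hpt⟩ := H t
    have halg : IsAlgebraic k (Ideal.Quotient.mk 𝔭 t) := by
      refine ⟨p, hp, ?_⟩
      rw [← Ideal.Quotient.mkₐ_eq_mk k, aeval_algHom_apply, Ideal.Quotient.mkₐ_eq_mk,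
        Ideal.Quotient.eq_zero_iff_mem]
      exact hpt
    exact halg.isIntegral
  exact isField_of_isIntegral_of_isField' (R := k) (S := A ⧸ 𝔭) (Field.toIsField k)

/-! The **generic fibre ring** `A ⊗_{k[X]} k(X)` of a `k[X]`-algebra `A` is realized as the
localization `Localization (Algebra.algebraMapSubmonoid A (nonZeroDivisors k[X]))` of `A` at the
image of `k[X] ∖ 0`, so that Mathlib's `localizationAlgebra` instance makes it an algebra over
`k(X) = FractionRing k[X]` (no abbreviation is introduced: this is a proof file). -/

/-- `k → k(X) → A ⊗_{k[X]} k(X)` is a scalar tower (over `k → k[X] → A`). [folklore] -/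
theorem isScalarTower_genericFibreRing (k A : Type) [Field k] [CommRing A] [Algebra k A]
    [Algebra k[X] A] [IsScalarTower k k[X] A] :
    IsScalarTower k (FractionRing k[X])
      (Localization (Algebra.algebraMapSubmonoid A (nonZeroDivisors k[X]))) :=
  IsScalarTower.of_algebraMap_eq fun c => by
    rw [IsScalarTower.algebraMap_apply k k[X] (FractionRing k[X]),
      ← IsScalarTower.algebraMap_apply k[X] (FractionRing k[X])
        (Localization (Algebra.algebraMapSubmonoid A (nonZeroDivisors k[X]))),
      IsScalarTower.algebraMap_apply k[X] A
        (Localization (Algebra.algebraMapSubmonoid A (nonZeroDivisors k[X]))),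
      ← IsScalarTower.algebraMap_apply k k[X] A, IsScalarTower.algebraMap_apply k A]

/-- The generic fibre ring of a finitely generated `k`-algebra is finitely generated over `k(X)`
(base change `k(X) ⊗_{k[X]} A ≅ A ⊗_{k[X]} k(X)`). [folklore] -/
theorem finiteType_genericFibreRing (k A : Type) [Field k] [CommRing A] [Algebra k A]
    [Algebra k[X] A] [IsScalarTower k k[X] A] [Algebra.FiniteType k A] :
    Algebra.FiniteType (FractionRing k[X])
      (Localization (Algebra.algebraMapSubmonoid A (nonZeroDivisors k[X]))) :=
  haveI : Algebra.FiniteType k[X] A := Algebra.FiniteType.of_restrictScalars_finiteType k k[X] A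
  (Algebra.FiniteType.baseChange (R := k[X]) (A := A) (FractionRing k[X])).equiv
    (Localization.tensorRightAlgEquiv (nonZeroDivisors k[X]) A)

/-- If `k[X] → A` is injective into a domain, the image of `k[X] ∖ 0` consists of
non-zero-divisors. [folklore] -/
theorem algebraMapSubmonoid_le_nonZeroDivisors (k A : Type) [Field k] [CommRing A] [IsDomain A]
    [Algebra k[X] A] (hinj : Function.Injective (algebraMap k[X] A)) :
    Algebra.algebraMapSubmonoid A (nonZeroDivisors k[X]) ≤ nonZeroDivisors A := by
  rintro _ ⟨p, hp, rfl⟩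
  exact mem_nonZeroDivisors_of_ne_zero
    ((map_ne_zero_iff _ hinj).mpr (nonZeroDivisors.ne_zero hp))

/-- The generic fibre ring of a domain in which `X` is transcendental is a domain. [folklore] -/
theorem isDomain_genericFibreRing (k A : Type) [Field k] [CommRing A] [IsDomain A]
    [Algebra k[X] A] (hinj : Function.Injective (algebraMap k[X] A)) :
    IsDomain (Localization (Algebra.algebraMapSubmonoid A (nonZeroDivisors k[X]))) :=
  IsLocalization.isDomain_localization (algebraMapSubmonoid_le_nonZeroDivisors k A hinj)

/-- **`dim (A ⊗_{k[X]} k(X)) = dim A - 1`** for a finitely generated `k`-domain `A` in which `X`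
is transcendental: both dimensions are transcendence degrees (`dim = trdeg` for affine domains,
Matsumura Thm. 5.6), and `trdeg_k A = trdeg_k A' = trdeg_k k(X) + trdeg_{k(X)} A' = 1 + dim A'`.
[cite: Matsumura1987, Thm. 5.6] -/
theorem ringKrullDim_genericFibreRing (k A : Type) [Field k] [CommRing A] [IsDomain A]
    [Algebra k A] [Algebra k[X] A] [IsScalarTower k k[X] A] [Algebra.FiniteType k A]
    (hinj : Function.Injective (algebraMap k[X] A)) {n : ℕ}
    (hdim : ringKrullDim A = (n + 1 : ℕ)) :
    ringKrullDim (Localization (Algebra.algebraMapSubmonoid A (nonZeroDivisors k[X]))) = n := by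
  haveI := isDomain_genericFibreRing k A hinj
  haveI := isScalarTower_genericFibreRing k A
  haveI := finiteType_genericFibreRing k A
  set K := FractionRing k[X]
  set A' := Localization (Algebra.algebraMapSubmonoid A (nonZeroDivisors k[X]))
  have hS := algebraMapSubmonoid_le_nonZeroDivisors k A hinj
  -- `trdeg_k A = n + 1` and `trdeg_K A' = dim A'`
  obtain ⟨m, hm, htr⟩ := exists_ringKrullDim_eq_and_trdeg_eq k A
  have hmn : m = n + 1 := by
    rw [hdim] at hm
    exact_mod_cast hm.symm
  subst hmn
  obtain ⟨d, hd, htr'⟩ := exists_ringKrullDim_eq_and_trdeg_eq K A'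
  -- the towers `k ⊆ A ⊆ A'` and `k ⊆ k[X] ⊆ K ⊆ A'`
  haveI : FaithfulSMul k A :=
    (faithfulSMul_iff_algebraMap_injective k A).mpr (algebraMap k A).injective
  haveI : FaithfulSMul A A' :=
    (faithfulSMul_iff_algebraMap_injective A A').mpr (IsLocalization.injective A' hS)
  haveI : FaithfulSMul k K :=
    (faithfulSMul_iff_algebraMap_injective k K).mpr (algebraMap k K).injective
  haveI : FaithfulSMul K A' :=
    (faithfulSMul_iff_algebraMap_injective K A').mpr (algebraMap K A').injective
  haveI : FaithfulSMul k k[X] :=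
    (faithfulSMul_iff_algebraMap_injective k k[X]).mpr (algebraMap k k[X]).injective
  haveI : FaithfulSMul k[X] K :=
    (faithfulSMul_iff_algebraMap_injective k[X] K).mpr (IsFractionRing.injective k[X] K)
  haveI : Algebra.IsAlgebraic A A' :=
    IsLocalization.isAlgebraic A' (Algebra.algebraMapSubmonoid A (nonZeroDivisors k[X]))
  haveI : Algebra.IsAlgebraic k[X] K := IsLocalization.isAlgebraic K (nonZeroDivisors k[X])
  have h1 : Algebra.trdeg k A' = Algebra.trdeg k A := by
    rw [← trdeg_add_eq k A (A := A'), trdeg_eq_zero (R := A) (A := A'), add_zero]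
  have h2 : Algebra.trdeg k K = 1 := by
    rw [← trdeg_add_eq k k[X] (A := K), trdeg_eq_zero (R := k[X]) (A := K), add_zero,
      Polynomial.trdeg_of_isDomain]
  have h3 : Algebra.trdeg k A' = Algebra.trdeg k K + Algebra.trdeg K A' :=
    (trdeg_add_eq k K (A := A')).symm
  rw [h1, htr, h2, htr'] at h3
  have h4 : ((n + 1 : ℕ) : Cardinal) = ((1 + d : ℕ) : Cardinal) := by
    rw [h3, Nat.cast_add, Nat.cast_one]
  have h5 : n + 1 = 1 + d := Nat.cast_inj.mp h4
  obtain rfl : d = n := by omega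
  exact hd

/-! ## Geometry: desingularizing local blow-ups through a threefold chart -/

/-- Desingularizations transport along isomorphisms: if `π : S₁ → S` is a `Sing S`-supported
blowing up along `Q` with regular source and `e : S ≅ T`, then `π ≫ e` is the blowing up of `T`
along `Q 𝒪_T` (flat base change along `e⁻¹`), supported in `Sing T = e(Sing S)`. [folklore] -/
theorem admitsDesingularization_of_iso {S T : Scheme.{u}} (e : S ≅ T)
    (h : Scheme.AdmitsDesingularization S) : Scheme.AdmitsDesingularization T := by
  obtain ⟨S₁, π, ⟨Q, hπ, hsupp⟩, hreg⟩ := h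
  refine ⟨S₁, π ≫ e.hom, ⟨Q.comap e.inv, ?_, ?_⟩, hreg⟩
  · have H : IsPullback (𝟙 S₁) (π ≫ e.hom) π e.inv := IsPullback.of_horiz_isIso ⟨by simp⟩
    exact hπ.of_isPullback_of_flat H
  · intro t ht
    rw [Scheme.IdealSheafData.support_comap] at ht
    have ht' : e.inv t ∈ (Q.support : Set S) := ht
    intro hreg'
    exact hsupp ht' ((mem_regularLocus_iff_of_flat_of_isPreimmersion e.inv t).mp hreg')

/-- **Local blow-ups of an integral threefold admit desingularizations, modulo Cossart–Piltant.**
Let `V` be an integral scheme, separated and of finite type over a field `K`, with `dim V = 3`,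
let `p : Y → V` be a blowing up along `J` and `v ∈ V`. Then the pro-open local scheme
`S'' = Y ×_V Spec 𝒪_{V,v}` admits a desingularization: if `J = 0` then `Y = ∅ = S''`; otherwise
`Y` is an integral threefold over `K` (an alteration of `V`), the twin theorem
`exists_isBlowup_singSupported_isRegular_dim3_of_cossartPiltant` gives a `Sing Y`-supported
blowing up `π : Bl_Q Y → Y` with regular source, and since `S'' → Y` is a flat preimmersion
(it identifies local rings, `S''_sing = S'' ∩ Y_sing`), `Bl_Q Y ×_Y S'' → S''` is the blowing up
along `Q 𝒪_{S''}` (flat base change), `Sing S''`-supported, with regular source.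
[cite: Temkin2008, §2.1 (p. 6–7) and Prop. 2.3.4 (iii)] [cite: CossartPiltant2019, Thm. 1.1 and Prop. 4.4] -/
theorem admitsDesingularization_proOpen_of_isBlowup_threefold
    (hG : CossartPiltant2019General.{u}) (hP : CossartPiltant2019Principalization.{u})
    {K : Type u} [Field K] {V Y : Scheme.{u}} (gV : V ⟶ Spec (.of K)) [IsSeparated gV]
    [LocallyOfFiniteType gV] [QuasiCompact gV] [IsIntegral V] (hdimV : topologicalKrullDim V = 3)
    {p : Y ⟶ V} {J : V.IdealSheafData} (hp : IsBlowup p J) (v : V) :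
    Scheme.AdmitsDesingularization (pullback p (V.fromSpecStalk v)) := by
  haveI : IsNoetherian V := Scheme.isNoetherian_of_finiteType_over_field gV
  by_cases hJ : J = ⊥
  · subst hJ
    haveI := hp.isEmpty_of_bot
    haveI : IsEmpty ↑(pullback p (V.fromSpecStalk v)) :=
      Function.isEmpty (pullback.fst p (V.fromSpecStalk v))
    exact Scheme.admitsDesingularization_of_isEmpty _
  haveI : IsIntegral Y := hp.isIntegral hJ
  haveI : IsProper p := hp.isProper
  have hdimY : topologicalKrullDim Y = 3 := by
    rw [← hdimV]
    exact IsAlteration.topologicalKrullDim_eq gV (isAlteration_of_isBlowup hp hJ)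
  obtain ⟨Q, Y₁, π, -, hQsing, hπ, hreg⟩ :=
    exists_isBlowup_singSupported_isRegular_dim3_of_cossartPiltant hG hP Y (p ≫ gV) hdimY
  haveI : Flat (V.fromSpecStalk v) := flat_fromSpecStalk V v
  refine ⟨pullback π (pullback.fst p (V.fromSpecStalk v)),
    pullback.snd π (pullback.fst p (V.fromSpecStalk v)),
    ⟨Q.comap (pullback.fst p (V.fromSpecStalk v)), hπ.pullback_snd_of_flat _, ?_⟩, ?_⟩
  · intro s hs
    rw [Scheme.IdealSheafData.support_comap] at hs
    have hs' : pullback.fst p (V.fromSpecStalk v) s ∈ (Q.support : Set Y) := hs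
    intro hsreg
    exact hQsing _ hs' ((Scheme.mem_regularLocus _).mp
      ((mem_regularLocus_iff_pullback_fst_fromSpecStalk p v s).mp hsreg))
  · intro t
    exact (Scheme.mem_regularLocus t).mp
      ((mem_regularLocus_iff_of_flat_of_isPreimmersion (pullback.fst π _) t).mpr
        ((Scheme.mem_regularLocus _).mpr (hreg _)))

/-- **Local blow-ups at points of a threefold chart.** If `ι : V → M` is a flat preimmersion
from an integral threefold `V` (separated of finite type over a field `K`) and `f : X' → M` is a
blowing up, then for every `v ∈ V` the local scheme `X' ×_M Spec 𝒪_{M,ι v}` admits a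
desingularization: `ι` identifies `𝒪_{M,ι v}` with `𝒪_{V,v}`, so by pullback pasting
`X' ×_M Spec 𝒪_{M,ι v} ≅ (X' ×_M V) ×_V Spec 𝒪_{V,v}`, where `X' ×_M V → V` is a blowing up
(flat base change); conclude by `admitsDesingularization_proOpen_of_isBlowup_threefold` and
transport along the isomorphism. [cite: Temkin2008, §2.1 (p. 6–7)] -/
theorem admitsDesingularization_pullback_fromSpecStalk_of_chart
    (hG : CossartPiltant2019General.{u}) (hP : CossartPiltant2019Principalization.{u})
    {K : Type u} [Field K] {V M X' : Scheme.{u}} (ι : V ⟶ M) [Flat ι] [IsPreimmersion ι]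
    (gV : V ⟶ Spec (.of K)) [IsSeparated gV] [LocallyOfFiniteType gV] [QuasiCompact gV]
    [IsIntegral V] (hdimV : topologicalKrullDim V = 3) {f : X' ⟶ M} {J : M.IdealSheafData}
    (hf : IsBlowup f J) (v : V) :
    Scheme.AdmitsDesingularization (pullback f (M.fromSpecStalk (ι v))) := by
  have hY : IsBlowup (pullback.snd f ι) (J.comap ι) := hf.pullback_snd_of_flat ι
  have h1 := admitsDesingularization_proOpen_of_isBlowup_threefold hG hP gV hdimV hY v
  haveI := isIso_stalkMap_of_flat_of_isPreimmersion ι v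
  let e₁ : pullback (pullback.snd f ι) (V.fromSpecStalk v) ≅ pullback f (V.fromSpecStalk v ≫ ι) :=
    pullbackLeftPullbackSndIso f ι (V.fromSpecStalk v)
  let e₂ : pullback f (V.fromSpecStalk v ≫ ι) ≅ pullback f (M.fromSpecStalk (ι v)) :=
    asIso (pullback.map f (V.fromSpecStalk v ≫ ι) f (M.fromSpecStalk (ι v)) (𝟙 X')
      (Spec.map (ι.stalkMap v)) (𝟙 M) (by simp) (by simp))
  exact admitsDesingularization_of_iso (e₁ ≪≫ e₂) h1

/-! ## The stub -/

/-- **Local desingularization at non-closed points of fourfolds** (stub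
`stub_localDesingNonClosed` of the line `closed-point-slice`, registered signature verbatim;
= `PrintedInputs → LocalDesingNonClosedFour`). For any field `k`, an integral separated
`k`-scheme of finite type `M` with `dim M = 4`, a NON-closed point `ζ ∈ M` and a blowing up
`f : X' → M` along `J`, the local scheme `X' ×_M Spec 𝒪_{M,ζ}` admits a desingularization,
modulo Cossart–Piltant 2019, Thm. 1.1 and Prop. 4.4. GENERIC-FIBRE TRICK: `M` is Jacobson, so in
an affine chart `U = Spec A ∋ ζ` the prime `𝔭` of `ζ` is not maximal and some `t ∈ A` has
transcendental residue at `ζ`; along `k[X] → A`, `X ↦ t`, the generic fibre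
`V = Spec (A ⊗_{k[X]} k(X))` is an integral THREEFOLD over `K = k(X)` (`dim = trdeg` drops by
one), `V → U ↪ M` is a flat preimmersion through which `ζ` factors, and
`admitsDesingularization_pullback_fromSpecStalk_of_chart` applies.
[cite: Temkin2008, Prop. 2.3.4 (iii) and §2.1] [cite: CossartPiltant2019, Thm. 1.1 and Prop. 4.4] -/
theorem stub_localDesingNonClosed
    (hG : CossartPiltant2019General.{0}) (hP : CossartPiltant2019Principalization.{0})
    (k : Type) [Field k] (M : Scheme.{0}) (g : M ⟶ Spec (.of k)) [IsSeparated g]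
    [LocallyOfFiniteType g] [QuasiCompact g] [IsIntegral M] (hdim : topologicalKrullDim M = 4)
    (ζ : M) (hζ : ¬ IsClosed ({ζ} : Set M))
    (X' : Scheme.{0}) (f : X' ⟶ M) (J : M.IdealSheafData) (hf : IsBlowup f J) :
    Scheme.AdmitsDesingularization (pullback f (M.fromSpecStalk ζ)) := by
  -- `M` is a Jacobson space
  haveI : JacobsonSpace M := LocallyOfFiniteType.jacobsonSpace g
  -- an affine open neighbourhood `U = Spec A` of `ζ`
  obtain ⟨U, hU, hζU, -⟩ :=
    exists_isAffineOpen_mem_and_subset (X := M) (x := ζ) (U := ⊤) trivial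
  haveI : Nonempty U := ⟨⟨ζ, hζU⟩⟩
  -- `A = Γ(M, U)` is a finitely generated `k`-domain of dimension `4`
  have hφ : RingHom.FiniteType (g.appLE ⊤ U le_top).hom :=
    HasRingHomProperty.appLE @LocallyOfFiniteType g ‹_› ⟨⊤, isAffineOpen_top _⟩ ⟨U, hU⟩ le_top
  let e : k ≃+* Γ(Spec (.of k), ⊤) := (Scheme.ΓSpecIso (.of k)).commRingCatIsoToRingEquiv.symm
  letI : Algebra k Γ(M, U) :=
    (((g.appLE ⊤ U le_top).hom : _ →+* _).comp e.toRingHom).toAlgebra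
  haveI : Algebra.FiniteType k Γ(M, U) :=
    hφ.comp (RingHom.FiniteType.of_surjective _ e.surjective)
  have hdimA : ringKrullDim Γ(M, U) = ((3 + 1 : ℕ) : WithBot ℕ∞) := by
    rw [← topologicalKrullDim_eq_ringKrullDim_of_isAffineOpen g hU ⟨ζ, hζU⟩, hdim]
    norm_num
  -- the prime `𝔭 ⊆ A` of `ζ` is not maximal (`M` is Jacobson and `ζ` is not closed)
  set z : PrimeSpectrum Γ(M, U) := hU.primeIdealOf ⟨ζ, hζU⟩ with hz
  have hzζ : hU.fromSpec z = ζ := hU.fromSpec_primeIdealOf ⟨ζ, hζU⟩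
  have hmax : ¬ z.asIdeal.IsMaximal := by
    intro hm
    apply hζ
    have h1 : IsClosed ({z} : Set (PrimeSpectrum Γ(M, U))) :=
      (PrimeSpectrum.isClosed_singleton_iff_isMaximal z).mpr hm
    have h2 : z ∈ hU.fromSpec ⁻¹' closedPoints M := by
      rw [hU.fromSpec.isOpenEmbedding.preimage_closedPoints]
      exact h1
    rw [← hzζ]
    exact h2
  -- a section `t ∈ A` with transcendental residue at `ζ`; `k[X] → A`, `X ↦ t`
  obtain ⟨t, ht⟩ := exists_forall_aeval_notMem_of_not_isMaximal (k := k) z.asIdeal hmax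
  letI : Algebra k[X] Γ(M, U) := (aeval (R := k) t).toRingHom.toAlgebra
  have halg : ∀ p : k[X], algebraMap k[X] Γ(M, U) p = aeval t p := fun p => rfl
  haveI : IsScalarTower k k[X] Γ(M, U) :=
    IsScalarTower.of_algebraMap_eq fun c => by rw [halg, Polynomial.algebraMap_eq, aeval_C]
  have hinj : Function.Injective (algebraMap k[X] Γ(M, U)) := by
    rw [injective_iff_map_eq_zero]
    intro p hp
    by_contra hp0
    exact ht p hp0 (by rw [← halg, hp]; exact zero_mem _)
  have hdisj : Disjoint (Algebra.algebraMapSubmonoid Γ(M, U) (nonZeroDivisors k[X]) : Set Γ(M, U))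
      z.asIdeal := by
    refine Set.disjoint_left.mpr ?_
    rintro _ ⟨p, hp, rfl⟩ hmem
    exact ht p (nonZeroDivisors.ne_zero hp) hmem
  -- the generic fibre `V = Spec (A ⊗_{k[X]} k(X))`, an integral threefold over `K = k(X)`,
  -- and the flat preimmersion `ι : V → U ↪ M`
  let A' : Type := Localization (Algebra.algebraMapSubmonoid Γ(M, U) (nonZeroDivisors k[X]))
  let K : Type := FractionRing k[X]
  haveI : IsDomain A' := isDomain_genericFibreRing k Γ(M, U) hinj
  haveI : Algebra.FiniteType K A' := finiteType_genericFibreRing k Γ(M, U)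
  let V : Scheme.{0} := Spec (.of A')
  let ι : V ⟶ M := Spec.map (CommRingCat.ofHom (algebraMap Γ(M, U) A')) ≫ hU.fromSpec
  let gV : V ⟶ Spec (.of K) := Spec.map (CommRingCat.ofHom (algebraMap K A'))
  haveI : Flat (Spec.map (CommRingCat.ofHom (algebraMap Γ(M, U) A'))) := by
    rw [Flat.SpecMap_iff]
    exact RingHom.flat_algebraMap_iff.mpr
      (IsLocalization.flat A' (Algebra.algebraMapSubmonoid Γ(M, U) (nonZeroDivisors k[X])))
  haveI : IsPreimmersion (Spec.map (CommRingCat.ofHom (algebraMap Γ(M, U) A'))) :=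
    IsPreimmersion.of_isLocalization (Algebra.algebraMapSubmonoid Γ(M, U) (nonZeroDivisors k[X]))
  haveI : Flat ι := inferInstance
  haveI : IsPreimmersion ι := inferInstance
  haveI : LocallyOfFiniteType gV := by
    rw [HasRingHomProperty.Spec_iff (P := @LocallyOfFiniteType)]
    exact RingHom.finiteType_algebraMap.mpr inferInstance
  have hdimV : topologicalKrullDim V = 3 := by
    show topologicalKrullDim (PrimeSpectrum A') = 3
    rw [PrimeSpectrum.topologicalKrullDim_eq_ringKrullDim]
    exact ringKrullDim_genericFibreRing k Γ(M, U) hinj hdimA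
  -- `ζ = ι ζ'` for the point `ζ' = 𝔭 A'` of the generic fibre
  let ζ' : V := ⟨z.asIdeal.map (algebraMap Γ(M, U) A'),
    IsLocalization.isPrime_of_isPrime_disjoint _ A' _ z.2 hdisj⟩
  have hζ'z : Spec.map (CommRingCat.ofHom (algebraMap Γ(M, U) A')) ζ' = z :=
    PrimeSpectrum.ext (IsLocalization.under_map_of_isPrime_disjoint _ A' z.2 hdisj)
  have hζ' : ι ζ' = ζ := by
    rw [← hzζ, ← hζ'z, Scheme.Hom.comp_apply]
  -- conclude through the chart
  have key := admitsDesingularization_pullback_fromSpecStalk_of_chart hG hP ι gV hdimV hf ζ'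
  rwa [hζ'] at key

end Summit.ResolutionOfSingularities.ResolutionOfSingularities.Theorems

end
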